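import Literature.NumberTheory.Automorphic.BrandtMatrixUnitCount
import Literature.NumberTheory.Automorphic.BrandtIndexReducedNorm
import HarnessLib

/-!
# Weight symmetry of Brandt matrices `w_i T(n)_ij = w_j T(n)_ji` from the "`n`-divisibility" of
# sub-ideals of index `n²` (Eichler's conjugate-ideal argument, made conditional on its one
# arithmetic input)

Topic `NumberTheory/Automorphic`; theorems only (no definition, no named fact, no instance).
A brick of the Brandt-module side of Pollack–Weston 2011, Thm. 6.8 (identification (iv) of
`PollackWestonCongruence.lean`: Gross's height pairing `⟨e_i, e_j⟩ = w_i δ_ij` "under which the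
action of `𝕋` is adjoint", PW §2.1), and of the named fact `brandtMatrix_weight_symm` of
`BrandtModule.lean` (Eichler 1973, II §6 Thm. 2 (17): `B(n)ᵀ = diag(e_i)⁻¹ B(n) diag(e_i)`).

Eichler's proof ((21)–(22) loc. cit.; Pizer 1980 §2; Gross 1987 §1) passes to conjugate
ideals: with `2 w_i T(n)_ij = #A_ij(n)`, `A_ij(n) = {α ∈ Dˣ : α I_i ⊆ I_j, [I_j : α I_i] = n²}`
(`BrandtMatrixUnitCount.lean`), the map **`α ↦ n α⁻¹`** is a bijection `A_ij(n) → A_ji(n)`,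
*provided* `n α⁻¹ I_j ⊆ I_i`, i.e. provided the sub-ideal `α I_i ⊆ I_j` of index `n²` contains
`n I_j`. This last point — "an integral ideal of reduced norm `n` divides `n`", equivalently the
integrality of the conjugate ideal — is where local principality of invertible ideals enters
(locally `α I_i = x_j γ O_p` with `γ ∈ O_p`, `nrd γ ∼ n`, and `n γ⁻¹ ∼ γ̄ ∈ O_p`); it is the only
arithmetic input and is NOT proved here. This file proves the implication, for any order data in
a quaternion algebra over `ℚ`:

* `Brandt.relIndex_natCast_smul` — `[I : n I] = n⁴` for a full `ℤ`-lattice `I` (rank `4`: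
  a `ℤ`-basis of `I` is a `ℚ`-basis of `D`; determinant of `n · id`);
* `Brandt.relIndex_conj_eq_sq` — if `n I_j ⊆ α I_i ⊆ I_j` with `[I_j : α I_i] = n²` then
  `[I_i : n α⁻¹ I_j] = n²` (translate by `α`, tower formula `n⁴ = n² · n²`);
* `Brandt.nonempty_equiv_of_nsmul_le` — under the `n`-divisibility hypothesis for the pairs
  `(i, j)` and `(j, i)`, `α ↦ n α⁻¹` is a bijection `A_ij(n) ≃ A_ji(n)`;
* `Brandt.weight_mul_matrix_symm_of_nsmul_le` — **`w_i T(n)_ij = w_j T(n)_ji`** under that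
  hypothesis (`n ≠ 0`; for `n = 0` both sides vanish, `Brandt.matrix_zero`), and the setup form
  `Brandt.XiSetup.weight_mul_matrix_symm_of_nsmul_le`.

The hypothesis, verbatim: `∀ α : Dˣ, α I_i ⊆ I_j → [I_j : α I_i] = n² → ∀ y ∈ I_j, n y ∈ α I_i`
(and symmetrically). Discharging it for the invertible right ideals of an Eichler order is the
local theory of orders (Voight, *Quaternion Algebras*, Main Thm. 16.6.1: invertible = locally
principal), absent from the tree.

## References

* M. Eichler, *The basis problem for modular forms and the traces of the Hecke operators*,
  LNM 320 (1973), Ch. II §6 Thm. 2 (17), (21)–(22) [Eichler1973].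
* A. Pizer, J. Algebra 64 (1980), §2 [Pizer1980].
* B. H. Gross, *Heights and the special values of L-series* (1987), §1 [Gross1987].
* R. Pollack, T. Weston, Compositio Math. 147 (2011), §2.1 [PollackWeston2011].
-/

noncomputable section

open scoped Pointwise nonZeroDivisors

universe u

namespace Literature.NumberTheory.Automorphic

namespace Brandt

section General

variable {D : Type u} [Ring D]

/-- Translating by `α` and then by `α⁻¹`-conjugated central-free bookkeeping: for units `α, ν`
with `α ν = ν α`, `α • ((ν * α⁻¹) • I) = ν • I`. [folklore] -/
theorem smul_conj_smul {α ν : Dˣ} (h : α * ν = ν * α) (I : Submodule ℤ D) :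
    α • ((ν * α⁻¹) • I) = ν • I := by
  rw [← mul_smul, ← mul_assoc, h, mul_assoc, mul_inv_cancel, mul_one]

/-- Membership in `ν • I` for the central unit `ν = n · 1`: `ν • y = n • y`. [folklore] -/
theorem units_smul_eq_zsmul_of_val_eq {ν : Dˣ} {n : ℤ} (hν : (ν : D) = n) (I : Submodule ℤ D)
    {y : D} (hy : y ∈ I) : n • y ∈ ν • I := by
  have : n • y = ν • y := by rw [Units.smul_def, smul_eq_mul, hν, zsmul_eq_mul]
  rw [this]
  exact Submodule.smul_mem_pointwise_smul y ν I hy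

/-- Conversely every element of `ν • I` (`ν = n · 1`) is `n • y`, `y ∈ I`. [folklore] -/
theorem exists_eq_zsmul_of_mem_units_smul {ν : Dˣ} {n : ℤ} (hν : (ν : D) = n) {I : Submodule ℤ D}
    {x : D} (hx : x ∈ ν • I) : ∃ y ∈ I, x = n • y := by
  obtain ⟨y, hy, rfl⟩ := (Submodule.mem_smul_pointwise_iff_exists x ν I).mp hx
  exact ⟨y, hy, by rw [Units.smul_def, smul_eq_mul, hν, zsmul_eq_mul]⟩

end General

section Quaternion

variable {D : Type u} [Ring D] [Algebra ℚ D] [IsQuaternionAlgebra ℚ D]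

omit [IsQuaternionAlgebra ℚ D] in
/-- The central unit `n · 1 ∈ Dˣ` (`n ≠ 0`). Stated as an existence to keep the file free of
definitions: there is `ν ∈ Dˣ` with `ν = n · 1`, commuting with everything. [folklore] -/
theorem exists_units_val_eq_natCast {n : ℕ} (hn : n ≠ 0) :
    ∃ ν : Dˣ, (ν : D) = (n : ℤ) ∧ ∀ α : Dˣ, α * ν = ν * α := by
  have hu : IsUnit (algebraMap ℚ D n) := (IsUnit.mk0 (n : ℚ) (by exact_mod_cast hn)).map _
  refine ⟨hu.unit, ?_, fun α => Units.ext ?_⟩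
  · rw [hu.unit_spec, map_natCast, Int.cast_natCast]
  · simp only [Units.val_mul, hu.unit_spec]
    exact (Algebra.commutes (n : ℚ) (α : D)).symm

/-- **`[I : n I] = n⁴`** for a full `ℤ`-lattice `I` in a quaternion algebra over `ℚ` and the
central unit `ν = n · 1`: the index is `|det (n · id_I)| = n^{rk I}` and `rk_ℤ I = dim_ℚ D = 4`
(a `ℤ`-basis of `I` is a `ℚ`-basis of `D`, `isLocalizedModule_subtype_of_isFullLattice`). [folklore] -/
theorem relIndex_natCast_smul {I : Submodule ℤ D} (hI : IsFullLattice D I) {n : ℕ} {ν : Dˣ}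
    (hν : (ν : D) = (n : ℤ)) : (ν • I).toAddSubgroup.relIndex I.toAddSubgroup = n ^ 4 := by
  classical
  haveI : IsAddTorsionFree D := isAddTorsionFree_of_charZero_module ℚ D
  haveI : Module.Finite ℤ I := Module.Finite.iff_fg.mpr hI.1
  haveI : IsAddTorsionFree I := I.toAddSubgroup.instIsAddTorsionFree
  have hν' : ∀ x ∈ I, LinearMap.mulLeft ℤ (ν : D) x ∈ I := fun x hx => by
    rw [LinearMap.mulLeft_apply, hν, ← zsmul_eq_mul]
    exact I.smul_mem _ hx
  rw [relIndex_units_smul_eq_natAbs_det hI.1 hν']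
  -- the restricted map is `n • id`
  have hg : (LinearMap.mulLeft ℤ (ν : D)).restrict hν' = ((n : ℤ) • LinearMap.id : I →ₗ[ℤ] I) := by
    apply LinearMap.ext
    intro x
    apply Subtype.ext
    show (ν : D) * (x : D) = (((n : ℤ) • x : I) : D)
    rw [Submodule.coe_smul, zsmul_eq_mul, hν]
  -- rank of `I` is `4`
  haveI := isLocalizedModule_subtype_of_isFullLattice hI
  let b := Module.Free.chooseBasis ℤ I
  let bQ : Module.Basis _ ℚ D := b.ofIsLocalizedModule ℚ ℤ⁰ I.subtype
  have hrank : Module.finrank ℤ I = 4 := by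
    rw [Module.finrank_eq_card_basis b, ← Module.finrank_eq_card_basis bQ,
      IsQuaternionAlgebra.finrank_eq_four (K := ℚ) (D := D)]
  rw [hg, LinearMap.det_smul, LinearMap.det_id, mul_one, hrank, Int.natAbs_pow, Int.natAbs_natCast]

/-- **Index of the conjugate sub-ideal**: if `n I_j ⊆ α I_i ⊆ I_j` with `[I_j : α I_i] = n²`
(`I_j` a full lattice, `ν = n · 1`, `n ≠ 0`), then `[I_i : (ν α⁻¹) I_j] = n²` — translate by `α`
(`[I_i : ν α⁻¹ I_j] = [α I_i : ν I_j]`) and use the tower `ν I_j ⊆ α I_i ⊆ I_j`: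
`[α I_i : ν I_j] · n² = [I_j : ν I_j] = n⁴`. [folklore] -/
theorem relIndex_conj_eq_sq {Ii Ij : Submodule ℤ D} (hIj : IsFullLattice D Ij) {n : ℕ} (hn : n ≠ 0)
    {ν : Dˣ} (hν : (ν : D) = (n : ℤ)) (hcomm : ∀ α : Dˣ, α * ν = ν * α) {α : Dˣ}
    (hle : α • Ii ≤ Ij) (hidx : (α • Ii).toAddSubgroup.relIndex Ij.toAddSubgroup = n ^ 2)
    (hstar : ν • Ij ≤ α • Ii) :
    ((ν * α⁻¹) • Ij).toAddSubgroup.relIndex Ii.toAddSubgroup = n ^ 2 := by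
  rw [← Brandt.relIndex_units_smul α ((ν * α⁻¹) • Ij) Ii, smul_conj_smul (hcomm α)]
  have htower := AddSubgroup.relIndex_mul_relIndex (ν • Ij).toAddSubgroup (α • Ii).toAddSubgroup
    Ij.toAddSubgroup (Submodule.toAddSubgroup_mono hstar) (Submodule.toAddSubgroup_mono hle)
  rw [hidx, relIndex_natCast_smul hIj hν] at htower
  have hn2 : 0 < n ^ 2 := by positivity
  refine Nat.eq_of_mul_eq_mul_right hn2 ?_
  rw [htower]
  ring

/-- **The conjugate-ideal bijection `α ↦ n α⁻¹`.** For classes `i, j` and `n ≠ 0`, *if* every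
sub-ideal `α I_i ⊆ I_j` of index `n²` contains `n I_j`, and symmetrically for `(j, i)`, then
`α ↦ (n · 1) α⁻¹` is a bijection
`{α : α I_i ⊆ I_j, [I_j : α I_i] = n²} ≃ {β : β I_j ⊆ I_i, [I_i : β I_j] = n²}` (its own inverse up
to the names). Stated as `Nonempty (_ ≃ _)`. [cite: Eichler1973, Ch. II §6 Thm. 2, (21)–(22)] -/
theorem nonempty_equiv_of_nsmul_le {O : Submodule ℤ D} (i j : ClassSet O) {n : ℕ} (hn : n ≠ 0)
    (hij : ∀ α : Dˣ, α • i.rep ≤ j.rep →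
      (α • i.rep).toAddSubgroup.relIndex j.rep.toAddSubgroup = n ^ 2 →
        ∀ y ∈ j.rep, (n : ℤ) • y ∈ α • i.rep)
    (hji : ∀ β : Dˣ, β • j.rep ≤ i.rep →
      (β • j.rep).toAddSubgroup.relIndex i.rep.toAddSubgroup = n ^ 2 →
        ∀ y ∈ i.rep, (n : ℤ) • y ∈ β • j.rep) :
    Nonempty ({α : Dˣ // α • i.rep ≤ j.rep ∧
        (α • i.rep).toAddSubgroup.relIndex j.rep.toAddSubgroup = n ^ 2} ≃
      {β : Dˣ // β • j.rep ≤ i.rep ∧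
        (β • j.rep).toAddSubgroup.relIndex i.rep.toAddSubgroup = n ^ 2}) := by
  obtain ⟨ν, hν, hcomm⟩ := exists_units_val_eq_natCast (D := D) hn
  have hIi : IsFullLattice D i.rep := i.rep_mem.1
  have hIj : IsFullLattice D j.rep := j.rep_mem.1
  -- the one-directional construction, for any pair of lattices
  have key : ∀ {Ii Ij : Submodule ℤ D}, IsFullLattice D Ij → ∀ {α : Dˣ}, α • Ii ≤ Ij →
      (α • Ii).toAddSubgroup.relIndex Ij.toAddSubgroup = n ^ 2 →
        (∀ y ∈ Ij, (n : ℤ) • y ∈ α • Ii) →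
          (ν * α⁻¹) • Ij ≤ Ii ∧
            ((ν * α⁻¹) • Ij).toAddSubgroup.relIndex Ii.toAddSubgroup = n ^ 2 := by
    intro Ii Ij hIj' α hle hidx hst
    have hstar : ν • Ij ≤ α • Ii := fun x hx => by
      obtain ⟨y, hy, rfl⟩ := exists_eq_zsmul_of_mem_units_smul hν hx
      exact hst y hy
    refine ⟨?_, relIndex_conj_eq_sq hIj' hn hν hcomm hle hidx hstar⟩
    rw [← Brandt.units_smul_le_units_smul_iff α, smul_conj_smul (hcomm α)]
    exact hstar
  have hinv : ∀ a : Dˣ, ν * (ν * a⁻¹)⁻¹ = a := fun a => by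
    rw [mul_inv_rev, inv_inv, ← mul_assoc, ← hcomm a, mul_inv_cancel_right]
  exact ⟨{ toFun := fun a => ⟨ν * a.1⁻¹, key hIj a.2.1 a.2.2 (hij a.1 a.2.1 a.2.2)⟩
           invFun := fun b => ⟨ν * b.1⁻¹, key hIi b.2.1 b.2.2 (hji b.1 b.2.1 b.2.2)⟩
           left_inv := fun a => Subtype.ext (hinv a.1)
           right_inv := fun b => Subtype.ext (hinv b.1) }⟩

/-- `1 ≠ -1` in a quaternion algebra over `ℚ`. [folklore] -/
theorem one_ne_neg_one_rat : (1 : D) ≠ -1 := by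
  haveI : Nontrivial D := Module.nontrivial_of_finrank_pos (R := ℚ)
    (by rw [IsQuaternionAlgebra.finrank_eq_four (K := ℚ) (D := D)]; norm_num)
  intro h
  have h2 : (2 : D) = 0 := by
    have : (1 : D) + 1 = 0 := by
      nth_rw 2 [h]
      exact add_neg_cancel 1
    rw [← this, one_add_one_eq_two]
  have h2' : algebraMap ℚ D 2 = 0 := by rw [map_ofNat, h2]
  rw [map_eq_zero_iff _ (algebraMap ℚ D).injective] at h2'
  exact two_ne_zero h2'

/-- **Weight symmetry of the Brandt matrices from `n`-divisibility of sub-ideals of index `n²`**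
(Eichler 1973 II §6 Thm. 2 (17), `B(n)ᵀ = diag(e)⁻¹ B(n) diag(e)`, made conditional on its
arithmetic input): for an order datum `O` in a quaternion algebra over `ℚ`, classes `i, j` and
`n`, if every `α I_i ⊆ I_j` with `[I_j : α I_i] = n²` contains `n I_j` and symmetrically, then
`w_i T(n)_ij = w_j T(n)_ji` — from `2 w_i T(n)_ij = #A_ij(n)` (`BrandtMatrixUnitCount.lean`) and the
bijection `α ↦ n α⁻¹ : A_ij(n) ≃ A_ji(n)`. [cite: Eichler1973, Ch. II §6 Thm. 2 eq. (17)] -/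
theorem weight_mul_matrix_symm_of_nsmul_le (O : Submodule ℤ D) (n : ℕ) (i j : ClassSet O)
    (hij : ∀ α : Dˣ, α • i.rep ≤ j.rep →
      (α • i.rep).toAddSubgroup.relIndex j.rep.toAddSubgroup = n ^ 2 →
        ∀ y ∈ j.rep, (n : ℤ) • y ∈ α • i.rep)
    (hji : ∀ β : Dˣ, β • j.rep ≤ i.rep →
      (β • j.rep).toAddSubgroup.relIndex i.rep.toAddSubgroup = n ^ 2 →
        ∀ y ∈ i.rep, (n : ℤ) • y ∈ β • j.rep) :
    (weight O i : ℤ) * matrix O n i j = (weight O j : ℤ) * matrix O n j i := by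
  haveI : IsAddTorsionFree D := isAddTorsionFree_of_charZero_module ℚ D
  rcases eq_or_ne n 0 with rfl | hn
  · rw [Brandt.matrix_zero]
    simp
  have h1 := two_mul_weight_mul_matrix_apply one_ne_neg_one_rat O n i j
  have h2 := two_mul_weight_mul_matrix_apply one_ne_neg_one_rat O n j i
  obtain ⟨e⟩ := nonempty_equiv_of_nsmul_le i j hn hij hji
  have hcard : (Nat.card {α : Dˣ // α • i.rep ≤ j.rep ∧
      (α • i.rep).toAddSubgroup.relIndex j.rep.toAddSubgroup = n ^ 2} : ℤ) =
      Nat.card {β : Dˣ // β • j.rep ≤ i.rep ∧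
        (β • j.rep).toAddSubgroup.relIndex i.rep.toAddSubgroup = n ^ 2} := by
    exact_mod_cast Nat.card_congr e
  have h : (2 : ℤ) * ((weight O i : ℤ) * matrix O n i j) =
      2 * ((weight O j : ℤ) * matrix O n j i) := by
    rw [← mul_assoc, ← mul_assoc, h1, h2, hcard]
  exact mul_left_cancel₀ two_ne_zero h

/-- **Setup form**: for a Brandt setup of type `(N⁺, N⁻)`, `w_i T(n)_ij = w_j T(n)_ji` as soon as
the `n`-divisibility of sub-ideals of index `n²` holds between the representatives of `i` and
`j` (the local-principality input of Eichler's proof). [cite: Eichler1973, Ch. II §6 Thm. 2 eq. (17)] -/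
theorem XiSetup.weight_mul_matrix_symm_of_nsmul_le {Nplus Nminus : ℕ} (S : XiSetup Nplus Nminus)
    (n : ℕ) (i j : ClassSet S.O)
    (hij : ∀ α : S.Dˣ, α • i.rep ≤ j.rep →
      (α • i.rep).toAddSubgroup.relIndex j.rep.toAddSubgroup = n ^ 2 →
        ∀ y ∈ j.rep, (n : ℤ) • y ∈ α • i.rep)
    (hji : ∀ β : S.Dˣ, β • j.rep ≤ i.rep →
      (β • j.rep).toAddSubgroup.relIndex i.rep.toAddSubgroup = n ^ 2 →
        ∀ y ∈ i.rep, (n : ℤ) • y ∈ β • j.rep) :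
    (weight S.O i : ℤ) * matrix S.O n i j = (weight S.O j : ℤ) * matrix S.O n j i :=
  Brandt.weight_mul_matrix_symm_of_nsmul_le S.O n i j hij hji

end Quaternion

end Brandt

end Literature.NumberTheory.Automorphic

end
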